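import Literature.Computability.AlgebraicComplexity.OrbitClosureEuclidean
import Literature.Computability.AlgebraicComplexity.MS2001GenericCircuitForm
import Literature.Computability.AlgebraicComplexity.MS2001FormESymmetries
import Literature.Computability.AlgebraicComplexity.DeterminantalComplexityProofs
import Literature.Computability.AlgebraicComplexity.IMMInVPProofs
import Literature.Computability.AlgebraicComplexity.ArithCircuitChain
import HarnessLib

/-!
# GCT I Prop. 7.7: if Conj. 7.5 fails, `E(X)` is approximated infinitesimally closely by circuits
# of polynomial size — PROOF ("Similar to that of Proposition 4.4"), with the circuit size of `H(Y)`

Topic `Computability/AlgebraicComplexity`. Cell `val-lit`, row MS2001-A (K. Mulmuley, M. Sohoni,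
*Geometric complexity theory I*, SIAM J. Comput. 31 (2001) 496–526), §7, typed from the AUTHORS'
VERSION (AV; text of record `HOME/bip/texts/MS2001-authorversion/`, locators «AV p.N, all.txt
Lnnnn»). The row «Prop 7.7» of `HOME/bip/CHECK-t01.md` was SKIPPED ("as 4.4"). Companion of
`MS2001Prop44Approximation.lean` (Prop. 4.4 for `perm` / `det`) and of
`MS2001GenericCircuitForm.lean` (the form `H(Y) = genericCircuitForm F k m`, Prop. 6.1). This
file proves the padding-and-approximation argument of Prop. 4.4 for an ARBITRARY form `g` in
place of `det(Y)`, records the size of the obvious circuit for `H(Y)`, and deduces Prop. 7.7.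
Theorems and bodied definitions only: no named facts, no instances, no `sorry`.

## The source (AV p.32, all.txt L2363–2391)

> **Conjecture 7.5** If `l = n^a`, where `a` is any fixed constant, then `E^φ(Y)` cannot lie in
> the (projective) Zariski closure `Δ[H(Y)]` of the `SL_l(F)`-orbit of `H(Y)` in `P(V)`. […]
> By Proposition 6.1, Conjecture 7.5 would imply that `E(X)` does not have an arithmetic circuit
> over `F` of size polynomial in `n`. The conjecture is not expected to be equivalent to the
> original lower bound question over `F`. But it is "almost" equivalent to it, when `F` is the
> field of complex numbers, in the following sense:
> **Proposition 7.7** If Conjecture 7.5 were false, then `E(X)` can be approximated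
> infinitesimally closely by an arithmetic circuit of poly(`n`) size.
> *Proof:* Similar to that of Proposition 4.4 Q.E.D.

## Contents

* §1–§2 `MS2001Prop77.padSubst ι y` — the substitution of the proof of Prop. 4.4 for a general
  placement: the variables `X` (placed in `Y` along an injection `ι`) are kept, the padding
  variable `y ∉ ι(X)` goes to `1`, all other variables of `Y` to `0`; it sends
  `f^φ(Y) = y^{D-d} f(X_ι)` back to `f(X)` (`aeval_padSubst_padded`), has values of degree `≤ 1`
  and circuit size `0`, and acts on coefficient vectors of degree-`D` forms by a matrix with
  entries of absolute value `≤ 1`.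
* §3 `exists_affine_aeval_approx_of_padded_mem_orbitClosure` — **the argument of Prop. 4.4 for
  an arbitrary form** `g(Y)` of degree `D` over `ℂ`: if `f^φ(Y) ∈ Δ[g]` (`f` a form of degree
  `d ≤ D` in the variables `X`), then for every `ε > 0` there is an AFFINE substitution `a`
  (`y_v ↦` an affine linear form in `X`, of circuit size `≤ 2 l`, `l = #Y`) such that every
  coefficient of `g(a) - f` has absolute value `< ε`. (Zariski = Euclidean closure of `GL_l · g`,
  `orbitClosure_eq_euclidean_closure_complex_holds`; a point `g(σ⁻¹Y)` of the orbit close to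
  `f^φ`; then `padSubst`.)
* §4 `complexity_genericCircuitForm_le` — **`H(Y)` has a circuit of size `O(l)`**:
  `L(H(Y)) ≤ (k m + 1)(3 m² + m)` for the generic circuit of depth `k` and width `m`
  (`l = m + m² + (k-1) m³`, `MS2001GenericCircuit.card_var`): all node forms `h(u)` are computed
  together, level by level (`complexity_chain_le`, Bürgisser 2000 Rem. 2.7), each
  `h(u) = ∑_{v,w} y^u_{v,w} h(v) h(w)` costing `3 m² + m` gates.
* §5 **Prop. 7.7** `MS2001_prop_7_7` — over `ℂ`: if `E^φ(Y) = y^{D-d} E(X_ι) ∈ Δ[H(Y)]` for the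
  generic circuit of depth `k ≥ 1` and width `m` (i.e. the instance of Conj. 7.5 fails), then for
  every `ε > 0` there is a polynomial `q(X) = H(a)`, `a` affine, of circuit size
  `L(q) ≤ (k m + 1)(3 m² + m) + 2 l²` — polynomial in `l` — all of whose coefficients are within
  `ε` of those of `E(X)` ("`E(X)` can be approximated infinitesimally closely by an arithmetic
  circuit of poly size"; under the conjecture's window `l = n^a` this is poly(`n`)).

## Rendering (disclosed)

* `E(X)` is the tree's `msE ℂ n kk` (the print's `m × km` variable matrix; degree `n · kk^n`,
  `MS2001FormE.msE_isHomogeneous`); `H(Y)` is `genericCircuitForm ℂ k m` of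
  `MS2001GenericCircuitForm.lean` (degree `D = 2^{k+1} - 1`); `E^φ(Y) = y^{D-d} E(X_ι)` for an
  injective placement `ι` of the variables of `E` among `Y` and a variable `y ∉ ι(X)` (as in
  Prop. 6.1, `MS2001_prop_6_1`, which needs `d ≤ D`).
* Conj. 7.5 is an OPEN PROBLEM and is not typed (conjectures are not Literature); as for
  `MS2001_prop_4_4_hasDetRepr`, the theorem takes the failure of its instance — membership
  `E^φ(Y) ∈ Δ[H(Y)]`, `Δ` = the tree's Zariski `orbitClosure` of the `GL_l`-orbit — as hypothesis.
* "approximated infinitesimally closely": for every `ε > 0`, every coefficient of `q - E(X)` has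
  absolute value `< ε`. "arithmetic circuit of poly(n) size": the explicit bound
  `(k m + 1)(3 m² + m) + 2 l²` on the tree's `complexity` (fan-in-two gate count), polynomial in
  the size `l` of `Y`.

Honest framing: literature typing; nothing here bears on any separation (`VP ≠ VNP`, `P ≠ NP`
are NOT proved); Conj. 7.5 is used only as a negated instance hypothesis.

## References

* [MulmuleySohoniSIAM2001] K. Mulmuley, M. Sohoni, *Geometric complexity theory I*, SIAM J.
  Comput. 31 (2001) 496–526, Prop. 7.7 (AV p.32, all.txt L2389–2391), Prop. 4.4 (AV p.14,
  L857–898), §6 (AV p.28, L2010–2057: the generic circuit and `H(Y)`).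
* [Burgisser2000] P. Bürgisser, *Completeness and Reduction in Algebraic Complexity Theory*,
  Springer 2000, §2.1 (subadditivity of `L`), Rem. 2.7 (`complexity_aeval_le`,
  `complexity_chain_le`).
-/

noncomputable section

open MvPolynomial

namespace Literature.Computability.AlgebraicComplexity

universe u v

/-! ## §1. The substitution `y ↦ 1`, `X ↦ X` along `ι`, foreign variables `↦ 0` -/

section Subst

variable {ρ : Type u} {τ : Type v} (ι : τ → ρ) (y : ρ)

open scoped Classical in
/-- The substitution of the proof of Prop. 4.4 / 7.7 (AV p.14 L883–886: "think of setting these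
variables of `Y` to zero … Setting `y` to one") for a placement `ι : X ↪ Y` with padding
variable `y`: `ι(x) ↦ x`, `y ↦ 1`, every other variable of `Y` `↦ 0`.
[cite: MulmuleySohoniSIAM2001, Prop. 4.4 proof (AV p.14, all.txt L883–886); Prop. 7.7 (AV p.32, L2391)] -/
def MS2001Prop77.padSubst (v : ρ) : MvPolynomial τ ℂ :=
  if h : ∃ x, ι x = v then X (Classical.choose h) else if v = y then 1 else 0

open MS2001Prop77

/-- On a placed variable the substitution is that variable. [cite: MulmuleySohoniSIAM2001, Prop. 4.4 proof (AV p.14, all.txt L883–886)] -/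
theorem MS2001Prop77.padSubst_apply (hι : Function.Injective ι) (x : τ) :
    padSubst ι y (ι x) = X x := by
  classical
  unfold padSubst
  have h : ∃ x', ι x' = ι x := ⟨x, rfl⟩
  rw [dif_pos h, hι (Classical.choose_spec h)]

/-- The padding variable goes to `1`. [cite: MulmuleySohoniSIAM2001, Prop. 4.4 proof (AV p.14, all.txt L886)] -/
theorem MS2001Prop77.padSubst_self (hy : ∀ x, ι x ≠ y) : padSubst ι y y = 1 := by
  classical
  unfold padSubst
  rw [dif_neg (fun ⟨x, hx⟩ => hy x hx), if_pos rfl]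

/-- Every value of the substitution has total degree `≤ 1`. [cite: MulmuleySohoniSIAM2001, Prop. 4.4 proof (AV p.14, all.txt L886–890)] -/
theorem MS2001Prop77.totalDegree_padSubst_le (v : ρ) : (padSubst ι y v).totalDegree ≤ 1 := by
  classical
  unfold padSubst
  split_ifs
  · exact (totalDegree_X _).le
  · rw [totalDegree_one]; exact Nat.zero_le _
  · rw [totalDegree_zero]; exact Nat.zero_le _

/-- Every value of the substitution (a variable, `1` or `0`) has circuit size `0`.
[cite: Burgisser2000, Def. 2.1] -/
theorem MS2001Prop77.complexity_padSubst (v : ρ) : complexity (padSubst ι y v) = 0 := by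
  classical
  unfold padSubst
  split_ifs
  · exact complexity_X_holds _
  · rw [← C_1]; exact complexity_C_holds _
  · rw [← C_0]; exact complexity_C_holds _

/-- Powers of the values of the substitution are monomials with coefficient `0` or `1`. [folklore] -/
private theorem MS2001Prop77.padSubst_pow_eq_monomial (v : ρ) (j : ℕ) :
    ∃ s : τ →₀ ℕ, ∃ c : ℂ, (c = 0 ∨ c = 1) ∧ padSubst ι y v ^ j = monomial s c := by
  classical
  unfold padSubst
  split_ifs
  · exact ⟨Finsupp.single _ j, 1, Or.inr rfl, by rw [X_pow_eq_monomial]⟩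
  · exact ⟨0, 1, Or.inr rfl, by rw [one_pow]; rfl⟩
  · rcases Nat.eq_zero_or_pos j with rfl | hj
    · exact ⟨0, 1, Or.inr rfl, by rw [pow_zero]; rfl⟩
    · exact ⟨0, 0, Or.inl rfl, by rw [zero_pow hj.ne', monomial_zero', C_0]⟩

/-- The substitution sends each monomial of `Y` to a monomial of `X` with coefficient `0` or `1`.
[folklore] -/
private theorem MS2001Prop77.aeval_padSubst_monomial_eq (d : ρ →₀ ℕ) :
    ∃ s : τ →₀ ℕ, ∃ c : ℂ, (c = 0 ∨ c = 1) ∧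
      aeval (padSubst ι y) (monomial d (1 : ℂ)) = monomial s c := by
  classical
  rw [aeval_monomial, map_one, one_mul, Finsupp.prod]
  induction d.support using Finset.induction_on with
  | empty => exact ⟨0, 1, Or.inr rfl, by rw [Finset.prod_empty]; rfl⟩
  | insert v s hv ih =>
    obtain ⟨s₁, c₁, hc₁, h₁⟩ := ih
    obtain ⟨s₂, c₂, hc₂, h₂⟩ := padSubst_pow_eq_monomial ι y v (d v)
    refine ⟨s₂ + s₁, c₂ * c₁, ?_, by rw [Finset.prod_insert hv, h₁, h₂, monomial_mul]⟩
    rcases hc₁ with rfl | rfl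
    · exact Or.inl (mul_zero _)
    · rcases hc₂ with rfl | rfl
      · exact Or.inl (zero_mul _)
      · exact Or.inr (mul_one _)

/-- The matrix entries of the substitution on coefficient vectors have absolute value `≤ 1`.
[folklore] -/
private theorem MS2001Prop77.norm_coeff_aeval_padSubst_monomial_le (d : ρ →₀ ℕ) (e : τ →₀ ℕ) :
    ‖coeff e (aeval (padSubst ι y) (monomial d (1 : ℂ)))‖ ≤ 1 := by
  classical
  obtain ⟨s, c, hc, h⟩ := aeval_padSubst_monomial_eq ι y d
  rw [h, coeff_monomial]
  split_ifs
  · rcases hc with rfl | rfl <;> simp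
  · simp

/-- **The substitution sends the padded form `y^j · f(X_ι)` back to `f(X)`** (AV p.14 L884–886:
"What remains is still an approximation … Setting `y` to one, we get … `perm(X)`"; here for any
`f`). [cite: MulmuleySohoniSIAM2001, Prop. 4.4 proof (AV p.14, all.txt L884–886)] -/
theorem MS2001Prop77.aeval_padSubst_padded (hι : Function.Injective ι) (hy : ∀ x, ι x ≠ y)
    (f : MvPolynomial τ ℂ) (j : ℕ) : aeval (padSubst ι y) (X y ^ j * rename ι f) = f := by
  rw [map_mul, map_pow, aeval_X, padSubst_self ι y hy, one_pow, one_mul, aeval_rename]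
  have h : (padSubst ι y ∘ ι) = X := funext fun x => padSubst_apply ι y hι x
  rw [h, aeval_X_left, AlgHom.coe_id, id]

end Subst

/-! ## §2. Coefficient bookkeeping -/

section Coeff

open MS2001Prop77

variable {ρ : Type u} {τ : Type v} {ι : τ → ρ} {y : ρ}

/-- For a form `g` of degree `D` in `Y`, each coefficient of its substitution is the linear
combination `∑_{|d| = D} coeff_d(g) · coeff_e(Y^d ∘ subst)` of the coefficients of `g`. [folklore] -/
private theorem MS2001Prop77.coeff_aeval_eq_sum [Fintype ρ] {D : ℕ}
    [Fintype {d : ρ →₀ ℕ // d.degree = D}] {g : MvPolynomial ρ ℂ} (hg : g.IsHomogeneous D)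
    (e : τ →₀ ℕ) :
    coeff e (aeval (padSubst ι y) g) =
      ∑ d : {d : ρ →₀ ℕ // d.degree = D},
        coeff d.1 g * coeff e (aeval (padSubst ι y) (monomial d.1 (1 : ℂ))) := by
  classical
  have hmem : ∀ d : ρ →₀ ℕ,
      d ∈ (Finset.univ : Finset ρ).finsuppAntidiag D ↔ d.degree = D := fun d => by
    simp [Finset.mem_finsuppAntidiag, Finsupp.degree_eq_sum]
  have hsupp : g.support ⊆ (Finset.univ : Finset ρ).finsuppAntidiag D := by
    intro d hd
    refine (hmem d).2 ?_
    rw [Finsupp.degree_eq_weight_one]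
    exact hg (mem_support_iff.1 hd)
  calc coeff e (aeval (padSubst ι y) g)
      = coeff e (aeval (padSubst ι y) (∑ d ∈ g.support, monomial d (coeff d g))) := by
        rw [← as_sum]
    _ = ∑ d ∈ g.support, coeff d g * coeff e (aeval (padSubst ι y) (monomial d (1 : ℂ))) := by
        rw [map_sum, coeff_sum]
        refine Finset.sum_congr rfl fun d _ => ?_
        rw [show monomial d (coeff d g) = coeff d g • monomial d (1 : ℂ) by
          rw [smul_monomial, smul_eq_mul, mul_one], map_smul, coeff_smul, smul_eq_mul]
    _ = ∑ d ∈ (Finset.univ : Finset ρ).finsuppAntidiag D,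
          coeff d g * coeff e (aeval (padSubst ι y) (monomial d (1 : ℂ))) :=
        Finset.sum_subset hsupp fun d _ hd => by rw [notMem_support_iff.1 hd, zero_mul]
    _ = _ := Finset.sum_subtype _ hmem _

end Coeff

/-! ## §3. The argument of Prop. 4.4 for an arbitrary form -/

section General

open MS2001Prop77

/-- **The proof of Prop. 4.4 / 7.7 for an arbitrary form `g`** (AV p.14 L864–898, "Similar to
that of Proposition 4.4", AV p.32 L2391). Over `ℂ`, let `g(Y)` be a form of degree `D` in the
`l` variables `Y`, `f(X)` a form of degree `d ≤ D`, `ι : X ↪ Y` a placement and `y ∉ ι(X)`. If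
the padded form `f^φ(Y) = y^{D-d} f(X_ι)` lies in the orbit closure `Δ[g]`, then for every
`ε > 0` there is an AFFINE substitution `a` (each `a(v)` an affine linear form in `X`, of
circuit size `≤ 2 l`) such that every coefficient of `g(a) - f` has absolute value `< ε`: "`f`
can be approximated infinitesimally closely" by affine projections of `g`. Proof as printed for
`det`: `f^φ` lies in the Euclidean closure of `GL_l · g` (Zariski = Euclidean,
`orbitClosure_eq_euclidean_closure_complex_holds`), take `g(σ⁻¹Y)` close to `f^φ`, set the
foreign variables to `0` and `y` to `1` (`padSubst`, continuous on coefficient vectors).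
[cite: MulmuleySohoniSIAM2001, Prop. 4.4 proof (AV p.14, all.txt L864–898); Prop. 7.7 (AV p.32, L2389–2391)] -/
theorem exists_affine_aeval_approx_of_padded_mem_orbitClosure {ρ : Type u} {τ : Type v}
    [Fintype ρ] [DecidableEq ρ] [Fintype τ] {g : MvPolynomial ρ ℂ} {D : ℕ}
    (hg : g.IsHomogeneous D) {f : MvPolynomial τ ℂ} {d : ℕ} (hf : f.IsHomogeneous d)
    (hdD : d ≤ D) {ι : τ → ρ} (hι : Function.Injective ι) {y : ρ} (hy : ∀ x, ι x ≠ y)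
    (h : X y ^ (D - d) * rename ι f ∈ orbitClosure g) {ε : ℝ} (hε : 0 < ε) :
    ∃ a : ρ → MvPolynomial τ ℂ, (∀ v, (a v).totalDegree ≤ 1) ∧
      (∀ v, complexity (a v) ≤ 2 * Fintype.card ρ) ∧
      ∀ e, ‖coeff e (aeval a g) - coeff e f‖ < ε := by
  classical
  haveI hfin : Fintype {e : ρ →₀ ℕ // e.degree = D} :=
    Fintype.subtype ((Finset.univ : Finset ρ).finsuppAntidiag D) fun e => by
      simp [Finset.mem_finsuppAntidiag, Finsupp.degree_eq_sum]
  haveI hfinE : Fintype {e : τ →₀ ℕ // e.degree ≤ D} :=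
    (Finsupp.finite_of_degree_le (σ := τ) D).fintype
  set ρc : MvPolynomial ρ ℂ → ({e : ρ →₀ ℕ // e.degree = D} → ℂ) :=
    fun p e => coeffVec p e.1 with hρc
  have hpad : (X y ^ (D - d) * rename ι f).IsHomogeneous D := by
    have := (isHomogeneous_X_pow (R := ℂ) y (D - d)).mul (hf.rename_isHomogeneous (f := ι))
    rwa [Nat.sub_add_cancel hdD] at this
  -- (1) `f^φ` lies in the Euclidean closure of `GL · g` (Zariski = Euclidean over `ℂ`)
  have hcl : ρc (X y ^ (D - d) * rename ι f) ∈ closure (ρc '' glOrbit ρ ℂ g) := by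
    rw [hρc, ← orbitClosure_eq_euclidean_closure_complex_holds hg]
    exact ⟨_, h, rfl⟩
  -- (2) the substitution, on coefficient vectors, is continuous
  set Λ : ({e : ρ →₀ ℕ // e.degree = D} → ℂ) → ({e : τ →₀ ℕ // e.degree ≤ D} → ℂ) :=
    fun c e => ∑ d', c d' * coeff e.1 (aeval (padSubst ι y) (monomial d'.1 (1 : ℂ))) with hΛ
  have hΛc : Continuous Λ :=
    continuous_pi fun e => continuous_finsetSum _ fun d' _ =>
      (continuous_apply d').mul continuous_const
  have hcl' : Λ (ρc (X y ^ (D - d) * rename ι f)) ∈ closure (Λ '' (ρc '' glOrbit ρ ℂ g)) :=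
    image_closure_subset_closure_image hΛc ⟨_, hcl, rfl⟩
  -- (3) an orbit point `g(σ⁻¹ Y)` whose substituted coefficients are `ε`-close
  obtain ⟨_, ⟨_, ⟨p, ⟨A, rfl⟩, rfl⟩, rfl⟩, hdist⟩ := Metric.mem_closure_iff.1 hcl' ε hε
  have hgh : (linSubstRep ρ ℂ A g).IsHomogeneous D := by
    rw [linSubstRep_apply]
    exact linSubst_isHomogeneous _ hg
  refine ⟨fun v => ∑ j, (A : Matrix ρ ρ ℂ) j v • padSubst ι y j, fun v => ?_, fun v => ?_, ?_⟩
  · refine (totalDegree_finsetSum _ _).trans (Finset.sup_le fun j _ => ?_)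
    exact (totalDegree_smul_le _ _).trans (totalDegree_padSubst_le ι y j)
  · refine (complexity_finset_sum_le _ _).trans ?_
    have hs : ∑ j, complexity ((A : Matrix ρ ρ ℂ) j v • padSubst ι y j) ≤ ∑ _j : ρ, 1 :=
      Finset.sum_le_sum fun j _ =>
        (complexity_smul_le_holds _ _).trans (by rw [complexity_padSubst])
    rw [Finset.sum_const, Finset.card_univ, smul_eq_mul, mul_one] at hs
    rw [Finset.card_univ]
    omega
  · have hcomp : aeval (fun v => ∑ j, (A : Matrix ρ ρ ℂ) j v • padSubst ι y j) g =
        aeval (padSubst ι y) (linSubstRep ρ ℂ A g) := by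
      have hab : (fun i => aeval (padSubst ι y)
          (∑ j, (A : Matrix ρ ρ ℂ) j i • (X j : MvPolynomial ρ ℂ))) =
          fun v => ∑ j, (A : Matrix ρ ρ ℂ) j v • padSubst ι y j := by
        funext v
        simp only [map_sum, map_smul, aeval_X]
      rw [linSubstRep_apply, linSubst, ← AlgHom.comp_apply, comp_aeval, hab]
    intro e
    rw [hcomp]
    by_cases he : e.degree ≤ D
    · have h1 := coeff_aeval_eq_sum (ι := ι) (y := y) hgh e
      have h2 : coeff e f = Λ (ρc (X y ^ (D - d) * rename ι f)) ⟨e, he⟩ := by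
        conv_lhs => rw [← aeval_padSubst_padded ι y hι hy f (D - d)]
        rw [coeff_aeval_eq_sum (ι := ι) (y := y) hpad e]
        rfl
      have h3 := (dist_pi_lt_iff hε).1 hdist ⟨e, he⟩
      rw [dist_comm, dist_eq_norm] at h3
      rw [h1, h2]
      exact h3
    · -- beyond degree `D` both coefficients vanish
      rw [not_le] at he
      have hq : coeff e (aeval (padSubst ι y) (linSubstRep ρ ℂ A g)) = 0 := by
        refine coeff_eq_zero_of_totalDegree_lt ?_
        change _ < e.degree
        exact ((HasDetRepr.totalDegree_aeval_le_of_le_one _ (totalDegree_padSubst_le ι y)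
          _).trans hgh.totalDegree_le).trans_lt he
      have hp : coeff e f = 0 := by
        refine coeff_eq_zero_of_totalDegree_lt ?_
        change _ < e.degree
        exact (hf.totalDegree_le.trans hdD).trans_lt he
      rw [hq, hp, sub_zero, norm_zero]
      exact hε

end General

/-! ## §4. The circuit size of `H(Y)` -/

section CircuitSize

open MS2001GenericCircuit

variable (F : Type u) [CommRing F] (k m : ℕ)

/-- One node of the generic circuit, `∑_{v,w} y^u_{v,w} · (h(v) h(w))` with the `y`'s and the
`h`'s read off as variables, costs at most `3 m² + m` gates. [cite: Burgisser2000, §2.1] -/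
private theorem MS2001Prop77.complexity_node_le {σ : Type v} (a : Fin m → Fin m → σ)
    (b c : Fin m → σ) :
    complexity (∑ v : Fin m, ∑ w : Fin m,
      (X (a v w) : MvPolynomial σ F) * (X (b v) * X (c w))) ≤ 3 * m ^ 2 + m := by
  have hterm : ∀ v w : Fin m,
      complexity ((X (a v w) : MvPolynomial σ F) * (X (b v) * X (c w))) ≤ 2 := by
    intro v w
    refine (complexity_mul_le_holds _ _).trans ?_
    have h1 := complexity_mul_le_holds (X (b v) : MvPolynomial σ F) (X (c w))
    rw [complexity_X_holds, complexity_X_holds] at h1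
    rw [complexity_X_holds]
    omega
  have hinner : ∀ v : Fin m, complexity (∑ w : Fin m,
      (X (a v w) : MvPolynomial σ F) * (X (b v) * X (c w))) ≤ 3 * m := by
    intro v
    refine (complexity_finset_sum_le _ _).trans ?_
    have := Finset.sum_le_sum fun w (_ : w ∈ (Finset.univ : Finset (Fin m))) => hterm v w
    rw [Finset.sum_const, Finset.card_univ, Fintype.card_fin, smul_eq_mul] at this
    rw [Finset.card_univ, Fintype.card_fin]
    omega
  refine (complexity_finset_sum_le _ _).trans ?_
  have := Finset.sum_le_sum fun v (_ : v ∈ (Finset.univ : Finset (Fin m))) => hinner v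
  rw [Finset.sum_const, Finset.card_univ, Fintype.card_fin, smul_eq_mul] at this
  rw [Finset.card_univ, Fintype.card_fin]
  nlinarith [this]

/-- Position of the node `(j, u)` (height `j < k`, `u < m`) in the evaluation table of the
generic circuit (the root sits at the last position `k m`). [folklore] -/
private def MS2001Prop77.pos (j : Fin k) (u : Fin m) : Fin (k * m + 1) :=
  Fin.castSucc (finProdFinEquiv (j, u))

/-- The evaluation table of the generic circuit: the node forms `h(u)` level by level, then the
root form `H(Y)`. [cite: MulmuleySohoniSIAM2001, §6 (AV p.28, all.txt L2019–2031)] -/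
private def MS2001Prop77.tab (t : Fin (k * m + 1)) : MvPolynomial (Var k m) F :=
  if h : (t : ℕ) < k * m then
    nodeVal F k m ((finProdFinEquiv.symm ⟨t, h⟩).1 : ℕ) (finProdFinEquiv.symm ⟨t, h⟩).2
  else genericCircuitForm F k m

/-- The recipe of each table entry in terms of the variables `Y` and the EARLIER entries: an
input node is the variable `y_u`; the node `u` at height `j + 1` is
`∑_{v,w} y^u_{v,w} · T(j,v) T(j,w)`; the root is `∑_{v,w} y_{v,w} · T(k-1,v) T(k-1,w)`.
[cite: MulmuleySohoniSIAM2001, §6 (AV p.28, all.txt L2019–2031)] -/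
private def MS2001Prop77.step (hk : 1 ≤ k) (t : Fin (k * m + 1)) :
    MvPolynomial (Var k m ⊕ Fin (k * m + 1)) F :=
  if h : (t : ℕ) < k * m then
    if hj : ((finProdFinEquiv.symm ⟨t, h⟩).1 : ℕ) = 0 then
      X (Sum.inl (Sum.inl (finProdFinEquiv.symm ⟨t, h⟩).2))
    else
      ∑ v : Fin m, ∑ w : Fin m,
        X (Sum.inl (Sum.inr (Sum.inr
          (⟨((finProdFinEquiv.symm ⟨t, h⟩).1 : ℕ) - 1, by
              have := (finProdFinEquiv.symm ⟨t, h⟩).1.2; omega⟩,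
            (finProdFinEquiv.symm ⟨t, h⟩).2, v, w)))) *
          (X (Sum.inr (MS2001Prop77.pos k m ⟨((finProdFinEquiv.symm ⟨t, h⟩).1 : ℕ) - 1, by
              have := (finProdFinEquiv.symm ⟨t, h⟩).1.2; omega⟩ v)) *
            X (Sum.inr (MS2001Prop77.pos k m ⟨((finProdFinEquiv.symm ⟨t, h⟩).1 : ℕ) - 1, by
              have := (finProdFinEquiv.symm ⟨t, h⟩).1.2; omega⟩ w)))
  else
    ∑ v : Fin m, ∑ w : Fin m,
      X (Sum.inl (Sum.inr (Sum.inl (v, w)))) *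
        (X (Sum.inr (MS2001Prop77.pos k m ⟨k - 1, by omega⟩ v)) *
          X (Sum.inr (MS2001Prop77.pos k m ⟨k - 1, by omega⟩ w)))

open MS2001Prop77

/-- Reading an earlier table entry: the entry at the position of node `(j, v)` is `h(v)` at
height `j`. [folklore] -/
private theorem MS2001Prop77.tab_pos (j : Fin k) (v : Fin m) :
    tab F k m (pos k m j v) = nodeVal F k m j v := by
  unfold tab pos
  have h : ((Fin.castSucc (finProdFinEquiv (j, v)) : Fin (k * m + 1)) : ℕ) < k * m := by
    rw [Fin.val_castSucc]
    exact (finProdFinEquiv (j, v)).2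
  rw [dif_pos h]
  have he : (⟨((Fin.castSucc (finProdFinEquiv (j, v)) : Fin (k * m + 1)) : ℕ), h⟩ : Fin (k * m)) =
      finProdFinEquiv (j, v) := Fin.ext (by rw [Fin.val_castSucc])
  rw [he, Equiv.symm_apply_apply]

/-- The table satisfies its recipe. [cite: MulmuleySohoniSIAM2001, §6 (AV p.28, all.txt L2019–2031)] -/
private theorem MS2001Prop77.tab_eq_aeval_step (hk : 1 ≤ k) (t : Fin (k * m + 1)) :
    tab F k m t = aeval (Sum.elim X (fun s : Fin (k * m + 1) =>
      if s < t then tab F k m s else 0)) (step F k m hk t) := by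
  -- reading an earlier node
  have hread : ∀ (j : Fin k) (v : Fin m), pos k m j v < t →
      aeval (Sum.elim X (fun s : Fin (k * m + 1) => if s < t then tab F k m s else 0))
        (X (Sum.inr (pos k m j v)) : MvPolynomial (Var k m ⊕ Fin (k * m + 1)) F) =
        nodeVal F k m j v := by
    intro j v hlt
    rw [aeval_X, Sum.elim_inr, if_pos hlt, tab_pos]
  by_cases h : (t : ℕ) < k * m
  · -- the node `(j, u)` at position `t = u + m j`
    have ht : (t : ℕ) = ((finProdFinEquiv.symm ⟨t, h⟩).2 : ℕ) +
        m * ((finProdFinEquiv.symm ⟨t, h⟩).1 : ℕ) := by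
      have := congrArg (fun x : Fin (k * m) => (x : ℕ))
        (finProdFinEquiv.apply_symm_apply (⟨t, h⟩ : Fin (k * m)))
      exact this.symm
    conv_lhs => rw [tab]
    conv_rhs => rw [step]
    rw [dif_pos h, dif_pos h]
    by_cases hj : ((finProdFinEquiv.symm ⟨t, h⟩).1 : ℕ) = 0
    · rw [dif_pos hj, hj, aeval_X, Sum.elim_inl, nodeVal_zero]
    · rw [dif_neg hj]
      have hj1 : ((finProdFinEquiv.symm ⟨t, h⟩).1 : ℕ) - 1 < k - 1 := by
        have := (finProdFinEquiv.symm ⟨t, h⟩).1.2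
        omega
      have hsucc : ((finProdFinEquiv.symm ⟨t, h⟩).1 : ℕ) =
          (((finProdFinEquiv.symm ⟨t, h⟩).1 : ℕ) - 1) + 1 := by omega
      have hm : m * (((finProdFinEquiv.symm ⟨t, h⟩).1 : ℕ) - 1) + m =
          m * ((finProdFinEquiv.symm ⟨t, h⟩).1 : ℕ) := by
        conv_rhs => rw [hsucc]
        ring
      have hlt : ∀ v : Fin m,
          pos k m ⟨((finProdFinEquiv.symm ⟨t, h⟩).1 : ℕ) - 1, by omega⟩ v < t := by
        intro v
        rw [Fin.lt_def]
        show (v : ℕ) + m * (((finProdFinEquiv.symm ⟨t, h⟩).1 : ℕ) - 1) < (t : ℕ)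
        have hv := v.2
        omega
      conv_lhs => rw [hsucc, nodeVal_succ F k m hj1]
      simp only [map_sum, map_mul]
      refine Finset.sum_congr rfl fun v _ => Finset.sum_congr rfl fun w _ => ?_
      rw [aeval_X, Sum.elim_inl, hread _ _ (hlt v), hread _ _ (hlt w)]
  · -- the root at position `k m`
    have ht : (t : ℕ) = k * m := by have := t.2; omega
    have hlt : ∀ v : Fin m, pos k m ⟨k - 1, by omega⟩ v < t := by
      intro v
      rw [Fin.lt_def, ht]
      show (v : ℕ) + m * (k - 1) < k * m
      have hv := v.2
      have hm : m * (k - 1) + m = k * m := by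
        rw [mul_comm k m, ← Nat.mul_succ, Nat.succ_eq_add_one, Nat.sub_add_cancel hk]
      omega
    conv_lhs => rw [tab]
    conv_rhs => rw [step]
    rw [dif_neg h, dif_neg h, genericCircuitForm]
    simp only [map_sum, map_mul]
    refine Finset.sum_congr rfl fun v _ => Finset.sum_congr rfl fun w _ => ?_
    rw [aeval_X, Sum.elim_inl, hread _ _ (hlt v), hread _ _ (hlt w)]

/-- Each recipe costs at most `3 m² + m` gates. [cite: Burgisser2000, §2.1] -/
private theorem MS2001Prop77.complexity_step_le (hk : 1 ≤ k) (t : Fin (k * m + 1)) :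
    complexity (step F k m hk t) ≤ 3 * m ^ 2 + m := by
  unfold step
  split_ifs
  · rw [complexity_X_holds]; exact Nat.zero_le _
  · exact complexity_node_le F m _ _ _
  · exact complexity_node_le F m _ _ _

/-- **`H(Y)` has a circuit of size `O(l)`**: the generic-circuit form of depth `k` and width
`m` satisfies `L(H(Y)) ≤ (k m + 1)(3 m² + m)` (all node forms computed together, level by
level; `l = #Y = m + m² + (k-1) m³`). GCT I §6 uses `H(Y)` as the universal form for circuits of
size `≤ r` (Prop. 6.1); this records that `H(Y)` itself is computed by a circuit of size linear
in `l`. [cite: MulmuleySohoniSIAM2001, §6 (AV p.28, all.txt L2010–2057)] -/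
theorem complexity_genericCircuitForm_le :
    complexity (genericCircuitForm F k m) ≤ (k * m + 1) * (3 * m ^ 2 + m) := by
  rcases Nat.eq_zero_or_pos k with rfl | hk
  · -- depth `0`: `H = ∑ y_{v,w} y_v y_w` directly
    rw [genericCircuitForm, zero_mul, zero_add, one_mul]
    simp only [Nat.zero_sub, nodeVal_zero]
    exact complexity_node_le F m _ _ _
  · have hlast : ¬ (((Fin.last (k * m) : Fin (k * m + 1)) : ℕ) < k * m) := by
      rw [Fin.val_last]; exact lt_irrefl _
    have htab : tab F k m (Fin.last (k * m)) = genericCircuitForm F k m := by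
      unfold tab; rw [dif_neg hlast]
    rw [← htab]
    refine (complexity_chain_le (tab F k m) (step F k m hk)
      (tab_eq_aeval_step F k m hk) (Fin.last (k * m))).trans ?_
    have := Finset.sum_le_sum fun s (_ : s ∈ (Finset.univ : Finset (Fin (k * m + 1)))) =>
      complexity_step_le F k m hk s
    rw [Finset.sum_const, Finset.card_univ, Fintype.card_fin, smul_eq_mul] at this
    exact this

end CircuitSize

/-! ## §5. Prop. 7.7 -/

section Prop77

open MS2001GenericCircuit

/-- **GCT I, Prop. 7.7** (AV p.32, all.txt L2389–2391): "If Conjecture 7.5 were false, then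
`E(X)` can be approximated infinitesimally closely by an arithmetic circuit of poly(`n`) size.
*Proof:* Similar to that of Proposition 4.4." Typed, like `MS2001_prop_4_4_hasDetRepr`, on the
failing instance: over `ℂ`, for the generic circuit of depth `k ≥ 1` and width `m` with variables
`Y` (`l = #Y = m + m² + (k-1) m³`), an injective placement `ι` of the `n · (n·kk)` variables `X` of
`E(X) = msE ℂ n kk` (a form of degree `d = n · kk^n ≤ D = 2^{k+1} - 1 = deg H(Y)`) and a
padding variable `y ∉ ι(X)`: if `E^φ(Y) = y^{D-d} E(X_ι) ∈ Δ[H(Y)]`, then for every `ε > 0`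
there is a polynomial `q(X) = H(a)`, `a` an affine substitution, of circuit size
`L(q) ≤ (k m + 1)(3 m² + m) + 2 l²` (polynomial in `l`; poly(`n`) in the window `l = n^a` of
Conj. 7.5), all of whose coefficients are within `ε` of those of `E(X)`.
[cite: MulmuleySohoniSIAM2001, Prop. 7.7 (AV p.32, all.txt L2389–2391)] -/
theorem MS2001_prop_7_7 {k m n kk : ℕ} (hk : 1 ≤ k)
    {ι : Fin n × (Fin n × Fin kk) → Var k m} (hι : Function.Injective ι) {y : Var k m}
    (hy : ∀ x, ι x ≠ y) (hd : n * kk ^ n ≤ 2 ^ (k + 1) - 1)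
    (h : X y ^ (2 ^ (k + 1) - 1 - n * kk ^ n) * rename ι (msE ℂ n kk) ∈
      orbitClosure (genericCircuitForm ℂ k m)) {ε : ℝ} (hε : 0 < ε) :
    ∃ q : MvPolynomial (Fin n × (Fin n × Fin kk)) ℂ,
      (∃ a : Var k m → MvPolynomial (Fin n × (Fin n × Fin kk)) ℂ,
        (∀ v, (a v).totalDegree ≤ 1) ∧ q = aeval a (genericCircuitForm ℂ k m)) ∧
      complexity q ≤ (k * m + 1) * (3 * m ^ 2 + m) + 2 * (m + m ^ 2 + (k - 1) * m ^ 3) ^ 2 ∧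
      ∀ e, ‖coeff e q - coeff e (msE ℂ n kk)‖ < ε := by
  obtain ⟨a, ha1, hac, hclose⟩ := exists_affine_aeval_approx_of_padded_mem_orbitClosure
    (isHomogeneous_genericCircuitForm ℂ k m hk) (MS2001FormE.msE_isHomogeneous (F := ℂ) n kk)
    hd hι hy h hε
  refine ⟨aeval a (genericCircuitForm ℂ k m), ⟨a, ha1, rfl⟩, ?_, hclose⟩
  refine (complexity_aeval_le _ _).trans (add_le_add (complexity_genericCircuitForm_le ℂ k m) ?_)
  calc ∑ v, complexity (a v) ≤ ∑ _v : Var k m, 2 * Fintype.card (Var k m) :=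
        Finset.sum_le_sum fun v _ => hac v
    _ = 2 * (m + m ^ 2 + (k - 1) * m ^ 3) ^ 2 := by
        rw [Finset.sum_const, Finset.card_univ, smul_eq_mul, card_var]
        ring

end Prop77

end Literature.Computability.AlgebraicComplexity
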